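import Mathlib
import Summits.Schanuel.Schanuel.Theses.RigidCore
import Summits.Schanuel.Schanuel.Theorems.AclSubsetLogFreeCore.Negative.LogFreeCoreCountable
import Literature.Barriers.Schanuel.AlgebraicIndependenceOfLogarithms
import Literature.Barriers.Schanuel.LargeTranscendenceDegreeSmallTrdegProofs

/-!
# Line `kernel-tower-relative-lw` (route `RigidCore`): vertical exactness at level `0`

Registered stub `stub_relLWZero_of_crux` of line `kernel-tower-relative-lw` of crux
`stmt-Schanuel-0970` (`Summit.Schanuel.Schanuel.Theses.RigidCore.SchanuelOnLogFreeCore`, (R) =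
Schanuel's conjecture for `ℚ`-linearly independent tuples from the log-free core
`C_EA = logFreeCore`).  The level-`0` layer `RelLW₀` of the line says: exponentials of elements of
`L₀ = stage 0 = ℚ(2πi)^{ralg}` that are `ℚ`-linearly independent MODULO `ℚ·2πi` are algebraically
independent OVER `L₀`.  This file proves the converse-direction calibration `(R) ⟹ RelLW₀`
(so, together with the tower reduction of the skeleton, the line's normal form is exact at
level `0`).

Proof.  Let `τ = 2πi` and `u ⊂ L₀` be independent modulo `ℚ·τ`.
1. `x = (τ, u)` lies in `C_EA` (`stage 0 ≤ logFreeCore`) and is `ℚ`-linearly independent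
   (a relation `c₀τ + ∑ cᵢuᵢ = 0` read modulo `ℚ·τ` kills the `cᵢ`, then `c₀ = 0` as `τ ≠ 0`).
2. (R) gives `r + 1 ≤ trdeg ℚ(x, e^x)`, and `ℚ(x, e^x) ≤ ℚ(τ, e^u, u)` (`e^τ = 1`).
3. Every `uᵢ` is algebraic over `F = ℚ(τ)`, so `trdeg ℚ(τ, e^u, u) = trdeg ℚ(τ, e^u)
   = trdeg ℚ(τ) + trdeg_F F(e^u) ≤ 1 + trdeg_F F(e^u)` (tower law), whence `r ≤ trdeg_F F(e^u)`.
4. Hence `e^u` is algebraically independent over `F`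
   (`Literature.Barriers.Schanuel.algebraicIndependent_of_le_trdeg_adjoin`), and therefore over the
   algebraic extension `L₀ = F^{ralg}` of `F` (Mathlib `AlgebraicIndependent.algebraicClosure`).

Everything used is proved in the tree / Mathlib; (R) is the hypothesis.  No new definitions.
-/

noncomputable section

open IntermediateField
open Summit.Schanuel.Schanuel.Theorems.AclSubsetLogFreeCore.Negative

namespace Summit.Schanuel.Schanuel.Theorems.RigidCore

namespace RelLWZeroOfCrux

/-- Tower law for generated extensions: `trdeg_K K(S ∪ T) = trdeg_K K(S) + trdeg_{K(S)} K(S)(T)`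
(`trdeg_add_eq` along `K ⊆ K(S) ⊆ K(S)(T) = K(S ∪ T)`, `adjoin_adjoin_left`). [folklore] -/
theorem trdeg_adjoin_union_eq_add {K E : Type*} [Field K] [Field E] [Algebra K E] (S T : Set E) :
    Algebra.trdeg K ↥(adjoin K (S ∪ T)) =
      Algebra.trdeg K ↥(adjoin K S) + Algebra.trdeg ↥(adjoin K S) ↥(adjoin (↥(adjoin K S)) T) := by
  haveI : FaithfulSMul (↥(adjoin K S)) (↥(adjoin (↥(adjoin K S)) T)) :=
    (faithfulSMul_iff_algebraMap_injective _ _).mpr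
      (algebraMap (↥(adjoin K S)) (↥(adjoin (↥(adjoin K S)) T))).injective
  have htower := trdeg_add_eq K (adjoin K S) (A := adjoin (adjoin K S) T)
  have heq : Algebra.trdeg K (adjoin (adjoin K S) T) = Algebra.trdeg K (adjoin K (S ∪ T)) := by
    rw [← (equivOfEq (adjoin_adjoin_left K S T)).trdeg_eq]
    rfl
  rw [← heq, ← htower]

/-- Adjoining elements that are algebraic over `K(S)` does not change the transcendence degree
over `K`: `trdeg_K K(S ∪ T) = trdeg_K K(S)` (the relative degree `trdeg_{K(S)} K(S)(T)` vanishes).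
[folklore] -/
theorem trdeg_adjoin_union_eq_of_isAlgebraic_adjoin {K E : Type*} [Field K] [Field E]
    [Algebra K E] (S T : Set E) (hT : ∀ a ∈ T, IsAlgebraic (↥(adjoin K S)) a) :
    Algebra.trdeg K ↥(adjoin K (S ∪ T)) = Algebra.trdeg K ↥(adjoin K S) := by
  haveI : Algebra.IsAlgebraic (adjoin K S) (adjoin (adjoin K S) T) :=
    IntermediateField.isAlgebraic_adjoin fun a ha => (hT a ha).isIntegral
  rw [trdeg_adjoin_union_eq_add,
    trdeg_eq_zero (R := ↥(adjoin K S)) (A := ↥(adjoin (↥(adjoin K S)) T)), add_zero]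

/-- The counting step, in pure field theory: if an intermediate field `L` with
`r + 1 ≤ trdeg_K L` lies in `K(S ∪ T ∪ U)`, where `U` is algebraic over `K(S ∪ T)` and
`trdeg_K K(S) ≤ 1`, then `r ≤ trdeg_{K(S)} K(S)(T)`. [folklore] -/
theorem le_trdeg_adjoin_of_tower {K E : Type*} [Field K] [Field E] [Algebra K E] {r : ℕ}
    (S T U : Set E) {L : IntermediateField K E}
    (hr : (r : Cardinal) + 1 ≤ Algebra.trdeg K L) (hL : L ≤ adjoin K ((S ∪ T) ∪ U))
    (hU : ∀ a ∈ U, IsAlgebraic (↥(adjoin K (S ∪ T))) a)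
    (hS : Algebra.trdeg K ↥(adjoin K S) ≤ 1) :
    (r : Cardinal) ≤ Algebra.trdeg ↥(adjoin K S) ↥(adjoin (↥(adjoin K S)) T) := by
  rw [← Cardinal.add_one_le_add_one_iff]
  calc (r : Cardinal) + 1 ≤ Algebra.trdeg K L := hr
    _ ≤ Algebra.trdeg K ↥(adjoin K ((S ∪ T) ∪ U)) := Literature.Barriers.Schanuel.trdeg_mono hL
    _ = Algebra.trdeg K ↥(adjoin K (S ∪ T)) :=
        trdeg_adjoin_union_eq_of_isAlgebraic_adjoin _ _ hU
    _ = Algebra.trdeg K ↥(adjoin K S) + Algebra.trdeg ↥(adjoin K S) ↥(adjoin (↥(adjoin K S)) T) :=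
        trdeg_adjoin_union_eq_add S T
    _ ≤ 1 + Algebra.trdeg ↥(adjoin K S) ↥(adjoin (↥(adjoin K S)) T) := add_le_add hS le_rfl
    _ = Algebra.trdeg ↥(adjoin K S) ↥(adjoin (↥(adjoin K S)) T) + 1 := add_comm _ _

/-- A tuple `u` that is `ℚ`-linearly independent modulo `ℚ·t`, `t ≠ 0`, extends to the
`ℚ`-linearly independent tuple `(t, u)`. [folklore] -/
theorem linearIndependent_cons_of_mkQ {r : ℕ} {t : ℂ} (ht : t ≠ 0) {u : Fin r → ℂ}
    (hli : LinearIndependent ℚ ((Submodule.span ℚ ({t} : Set ℂ)).mkQ ∘ u)) :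
    LinearIndependent ℚ (Fin.cons t u : Fin (r + 1) → ℂ) := by
  refine linearIndependent_finCons.mpr ⟨LinearIndependent.of_comp _ hli, fun hmem => ?_⟩
  obtain ⟨c, hc⟩ := (Submodule.mem_span_range_iff_exists_fun ℚ).mp hmem
  have hsum : ∑ i, c i • ((Submodule.span ℚ ({t} : Set ℂ)).mkQ ∘ u) i = 0 := by
    have h1 : (Submodule.span ℚ ({t} : Set ℂ)).mkQ (∑ i, c i • u i) = 0 := by
      rw [hc, Submodule.mkQ_apply, Submodule.Quotient.mk_eq_zero]
      exact Submodule.mem_span_singleton_self t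
    simpa only [map_sum, map_smul, Function.comp_apply] using h1
  have hc0 : ∀ i, c i = 0 := Fintype.linearIndependent_iff.mp hli c hsum
  refine ht ?_
  rw [← hc]
  exact Finset.sum_eq_zero fun i _ => by rw [hc0 i, zero_smul]

/-- **The count under (R)**: for `u ⊂ L₀` independent modulo `ℚ·2πi`, the exponentials `e^u` are
algebraically independent over `F = ℚ(2πi)` — (R) at the `ℚ`-free core tuple `(2πi, u)` gives
`r + 1 ≤ trdeg ℚ(2πi, u, 1, e^u) = trdeg ℚ(2πi) + trdeg_F F(e^u) ≤ 1 + trdeg_F F(e^u)`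
(`u` algebraic over `F`), so `r ≤ trdeg_F F(e^u)` and
`Literature.Barriers.Schanuel.algebraicIndependent_of_le_trdeg_adjoin` applies. [folklore] -/
theorem algebraicIndependent_exp_over_adjoin
    (hR : Summit.Schanuel.Schanuel.Theses.RigidCore.SchanuelOnLogFreeCore)
    (r : ℕ) (u : Fin r → ℂ) (hu : ∀ i, u i ∈ stage 0)
    (hli : LinearIndependent ℚ
      ((Submodule.span ℚ ({(2 * ↑Real.pi * Complex.I : ℂ)} : Set ℂ)).mkQ ∘ u)) :
    AlgebraicIndependent (↥(adjoin ℚ ({(2 * ↑Real.pi * Complex.I : ℂ)} : Set ℂ)))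
      (fun i => Complex.exp (u i)) := by
  -- (1) the tuple `(2πi, u)` lies in the core and is `ℚ`-linearly independent
  have hcore :
      ∀ i, (Fin.cons (2 * (Real.pi : ℂ) * Complex.I) u : Fin (r + 1) → ℂ) i ∈ logFreeCore := by
    intro i
    refine Fin.cases ?_ (fun j => ?_) i
    · rw [Fin.cons_zero]
      exact two_pi_I_mem_logFreeCore
    · rw [Fin.cons_succ]
      exact stage_le_of_mem logFreeCore_mem_coreFamily 0 (hu j)
  have hxli :
      LinearIndependent ℚ (Fin.cons (2 * (Real.pi : ℂ) * Complex.I) u : Fin (r + 1) → ℂ) :=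
    linearIndependent_cons_of_mkQ two_pi_I_ne_zero' hli
  -- (2) the crux at `(2πi, u)`
  have hRx := hR (r + 1) (Fin.cons (2 * (Real.pi : ℂ) * Complex.I) u) hcore hxli
  -- (3) `ℚ(x, e^x) ≤ ℚ(2πi, e^u, u)`
  have hle :
      adjoin ℚ (Set.range (Fin.cons (2 * (Real.pi : ℂ) * Complex.I) u : Fin (r + 1) → ℂ) ∪
          Set.range
            (Complex.exp ∘ (Fin.cons (2 * (Real.pi : ℂ) * Complex.I) u : Fin (r + 1) → ℂ))) ≤
        adjoin ℚ (((({(2 * (Real.pi : ℂ) * Complex.I)} : Set ℂ) ∪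
          Set.range fun i => Complex.exp (u i)) ∪ Set.range u)) := by
    rw [adjoin_le_iff]
    rintro a (⟨i, rfl⟩ | ⟨i, rfl⟩)
    · refine Fin.cases ?_ (fun j => ?_) i
      · rw [Fin.cons_zero]
        exact subset_adjoin ℚ _ (Or.inl (Or.inl rfl))
      · rw [Fin.cons_succ]
        exact subset_adjoin ℚ _ (Or.inr ⟨j, rfl⟩)
    · refine Fin.cases ?_ (fun j => ?_) i
      · rw [Function.comp_apply, Fin.cons_zero, Complex.exp_two_pi_mul_I]
        exact one_mem _
      · rw [Function.comp_apply, Fin.cons_succ]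
        exact subset_adjoin ℚ _ (Or.inl (Or.inr ⟨j, rfl⟩))
  -- (4) `u` is algebraic over `ℚ(2πi) ≤ ℚ(2πi, e^u)`
  have hU : ∀ a ∈ Set.range u, IsAlgebraic
      (↥(adjoin ℚ ((({(2 * (Real.pi : ℂ) * Complex.I)} : Set ℂ) ∪
        Set.range fun i => Complex.exp (u i))))) a := by
    rintro _ ⟨i, rfl⟩
    exact isAlgebraic_of_le (adjoin.mono ℚ _ _ Set.subset_union_left) (mem_relAlg_iff.mp (hu i))
  -- (5) count and conclude
  have hcount := le_trdeg_adjoin_of_tower (K := ℚ) ({(2 * (Real.pi : ℂ) * Complex.I)} : Set ℂ)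
    (Set.range fun i => Complex.exp (u i)) (Set.range u)
    (by rw [← Nat.cast_add_one]; exact hRx) hle hU
    (Literature.Barriers.Schanuel.trdeg_adjoin_singleton_le_one _)
  exact Literature.Barriers.Schanuel.algebraicIndependent_of_le_trdeg_adjoin _ hcount

end RelLWZeroOfCrux

/-- **Registered stub `stub_relLWZero_of_crux` of line `kernel-tower-relative-lw`** (signature
verbatim) — vertical exactness at level `0`, `(R) ⟹ RelLW₀`: under Schanuel's conjecture for the
log-free core, exponentials of elements of `L₀ = stage 0 = ℚ(2πi)^{ralg}` that are `ℚ`-linearly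
independent modulo `ℚ·2πi` are algebraically independent over `L₀`.  From
`RelLWZeroOfCrux.algebraicIndependent_exp_over_adjoin` (independence over `ℚ(2πi)`) by passing to
the algebraic extension `L₀ = ℚ(2πi)^{ralg}` (Mathlib `AlgebraicIndependent.algebraicClosure`).
[folklore] -/
theorem stub_relLWZero_of_crux :
    Summit.Schanuel.Schanuel.Theses.RigidCore.SchanuelOnLogFreeCore →
      ∀ (r : ℕ) (u : Fin r → ℂ), (∀ i, u i ∈ stage 0) →
        LinearIndependent ℚ ((Submodule.span ℚ ({(2 * ↑Real.pi * Complex.I : ℂ)} : Set ℂ)).mkQ ∘ u) →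
          AlgebraicIndependent (↥(stage 0)) (fun i => Complex.exp (u i)) := by
  intro hR r u hu hli
  exact (RelLWZeroOfCrux.algebraicIndependent_exp_over_adjoin hR r u hu hli).algebraicClosure

end Summit.Schanuel.Schanuel.Theorems.RigidCore

end
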